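import Summits.QuantumFields.YangMills.Theorems.BalabanUVNodesN15BlockRowsMatrix
import HarnessLib

/-!
# N15 = NE2, road (c) — PROGRAMME (PC), towards (PC-D) «the per-cube LANDAU LETTER»: rows of `A·C·Bᵀ` with WEIGHTED exponential rows for `A` and `B` — n15-c∕213
# `hasMaj_mul_mul_transpose_exp` with near∕far weights `u(z)`, `v(z′)` on the two fine-indexed factors, and the one-difference expansion of `A·C·Aᵀ − A₁·C₁·A₁ᵀ`
# (dag-n15-c g29, n15-c∕306)

Cell `pub-ymgap`, seat `pub-ymgap-dag-n15-c` (generation g29; R134 (a), s1; HUMAN RULING D-0062).  `bears_on: R4∕N15 · K3⁸ SpineGivenEndpointR13SepCoPHV (stmt-QuantumFields-27366)`;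
filed `--kind proof --supports stmt-QuantumFields-27366 --as helper` — COUNT-NEUTRAL.  Generic finite bookkeeping ([folklore]); theorems only, 0 `def`, 0 `sorry`; NO estimate of
Bałaban's.  Imports BY NAME n15-c∕213 `…BlockRowsMatrix` (`hasMaj_mul_mul_transpose`, `conv3_exp_le`).  Nothing in the tree is modified.

WHY ((PC-D), HOME `PCD-DESIGN-g28.md`, decision of g29).  The per-cube Landau letter `D_V(I − R(V))D*_V − ∂(I − R(𝟙))∂ᵀ` is read through n15-c∕212's factorisation
`D(I−R)Dᵀ = E·S⁻¹·Eᵀ` (`E = DG′Q′ᵀ : fine 1-forms ← coarse scalars`, `S = Q′G′²Q′ᵀ`) and its one-difference expansion `landauCov_sub_factorised`: three words `(E−E₁)S⁻¹Eᵀ`,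
`E₁(S⁻¹−S₁⁻¹)Eᵀ`, `E₁S₁⁻¹(E−E₁)ᵀ`.  The block rows of such words come from the rows of the fine-indexed factors ALONE (n15-c∕213: the transposed factor pairs with whole fine blocks,
a factor `N = #block` that the scale `n^{−(d+1)}` of `Q′ᵀ` cancels) — so the ADJOINT entry `G′∇*` of (3.42) and its closeness are NOT needed, only entry 2 (n15-c∕305).  The closeness rows
carry near∕far weights `s + f·e^{−κd_Z}` at the fine output; THIS FILE lets such weights ride through n15-c∕213's device.

WHAT.  `hasMaj_mul_mul_transpose_expW`: `A ≤ u(z)·a e^{−δd}`, `C ≤ γe^{−δd}`, `B ≤ v(z′)·b e^{−δd}` (`u, v ≥ 0` any functions of the fine block) ⟹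
`A·C·Bᵀ ≤ u(z)v(z′)·N·N_Y²·aγb·c²·e^{−(δ−σ)d(z,z′)}`; `mulVecLin_mmul3_transpose_sub` (`ACAᵀ − A₁C₁A₁ᵀ = (A−A₁)CAᵀ + A₁(C−C₁)Aᵀ + A₁C₁(A−A₁)ᵀ`, restated for `Matrix.mulVecLin`).

HONEST FRAMING ∕ LIMITS.  Bookkeeping only; [B9] (3.49) p.399 and [B6] (2.52)–(2.56) pp.232–233 are the SHAPES served; NE2⁺ NOT PRINTED; N15 of record untouched; K3⁸ OPEN; counts
UNMOVED.  Restate-immune (no Theses import).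
-/

noncomputable section

open scoped BigOperators Matrix
open Finset

namespace Summit.QuantumFields.YangMills.BalabanUVNodes.N15.BlockRows

open Literature.MathematicalPhysics.QuantumFieldTheory.Balaban1983to89
open Literature.MathematicalPhysics.QuantumFieldTheory.Balaban1983to89.B11SectG (BlockNorm HasMaj RowSum)
open Literature.MathematicalPhysics.QuantumFieldTheory.Balaban1983to89.B6RandomWalk (Triangle254)
open Literature.MathematicalPhysics.QuantumFieldTheory.Balaban1983to89.T4EtaRateCoeffDefect (fibre)

variable {g : B6.Geometry}

section Weighted

variable {P Y : Type} [Fintype P] [Fintype Y] [DecidableEq P] [DecidableEq Y] [DecidableEq g.Site]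

/-- ★★ **`A·C·Bᵀ` WITH WEIGHTED EXPONENTIAL ROWS**: `A ≤ u(z)·a e^{−δd}`, `C ≤ γ e^{−δd}`, `B ≤ v(z′)·b e^{−δd}` (`u, v ≥ 0` functions of the fine block — near∕far weights
`s + f e^{−κd_Z}` in the sequel) ⟹ `A·C·Bᵀ ≤ u(z)·v(z′)·N·N_Y²·a·γ·b·c²·e^{−(δ−σ)d(z,z′)}`: the weights of the two fine-indexed factors factor out of n15-c∕213's double sum.
[cite: Balaban1985BackgroundPropagators, (3.49) p.399 (mechanism); Balaban1984PropagatorsII, (2.52)–(2.56) pp.232–233] -/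
theorem hasMaj_mul_mul_transpose_expW (blkP : P → g.Site) (blkY : Y → g.Site) {A B : Matrix P Y ℝ} {C : Matrix Y Y ℝ} {a b γ δ σ c : ℝ} {N NY : ℕ} {u v : g.Site → ℝ}
    (htri : Triangle254 g) (hd : ∀ a b : g.Site, 0 ≤ g.dist a b) (hsymm : ∀ a b : g.Site, g.dist a b = g.dist b a) (hrow : RowSum g σ c) (hσ : 0 < σ) (hσδ : σ ≤ δ)
    (ha : 0 ≤ a) (hb : 0 ≤ b) (hγ : 0 ≤ γ) (hu : ∀ z, 0 ≤ u z) (hv : ∀ z, 0 ≤ v z) (hN : ∀ z, (fibre blkP z).card ≤ N) (hNY : ∀ w, (fibre blkY w).card ≤ NY)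
    (hA : HasMaj (BlockNorm.ofBlocks g blkY) (BlockNorm.ofBlocks g blkP) (Matrix.mulVecLin A) (fun z w => u z * (a * Real.exp (-(δ * g.dist z w)))))
    (hB : HasMaj (BlockNorm.ofBlocks g blkY) (BlockNorm.ofBlocks g blkP) (Matrix.mulVecLin B) (fun z w => v z * (b * Real.exp (-(δ * g.dist z w)))))
    (hC : HasMaj (BlockNorm.ofBlocks g blkY) (BlockNorm.ofBlocks g blkY) (Matrix.mulVecLin C) (fun w w' => γ * Real.exp (-(δ * g.dist w w')))) :
    HasMaj (BlockNorm.ofBlocks g blkP) (BlockNorm.ofBlocks g blkP) (Matrix.mulVecLin (A * C * Bᵀ))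
      (fun z z' => u z * v z' * (N * NY * NY * a * γ * b * (c * c)) * Real.exp (-((δ - σ) * g.dist z z'))) := by
  refine (hasMaj_mul_mul_transpose blkP blkY (fun z _ => mul_nonneg (hu z) (by positivity)) (fun z _ => mul_nonneg (hv z) (by positivity)) (fun _ _ => by positivity) hN hNY hA hB hC).mono
    fun z z' => ?_
  have h := conv3_exp_le htri hd hsymm hrow hσ hσδ z z'
  have huv : 0 ≤ u z * v z' := mul_nonneg (hu z) (hv z')
  calc (N : ℝ) * NY * NY * ∑ w : g.Site, ∑ w' : g.Site, u z * (a * Real.exp (-(δ * g.dist z w))) * (γ * Real.exp (-(δ * g.dist w w'))) * (v z' * (b * Real.exp (-(δ * g.dist z' w'))))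
      = N * NY * NY * ((u z * v z' * (a * γ * b)) * ∑ w : g.Site, ∑ w' : g.Site, Real.exp (-(δ * g.dist z w)) * Real.exp (-(δ * g.dist w w')) * Real.exp (-(δ * g.dist z' w'))) := by
        congr 1
        rw [Finset.mul_sum]
        refine Finset.sum_congr rfl fun w _ => ?_
        rw [Finset.mul_sum]
        exact Finset.sum_congr rfl fun w' _ => by ring
    _ ≤ N * NY * NY * ((u z * v z' * (a * γ * b)) * (c * c * Real.exp (-((δ - σ) * g.dist z z')))) :=
        mul_le_mul_of_nonneg_left (mul_le_mul_of_nonneg_left h (mul_nonneg huv (by positivity))) (by positivity)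
    _ = u z * v z' * (N * NY * NY * a * γ * b * (c * c)) * Real.exp (-((δ - σ) * g.dist z z')) := by ring

omit [DecidableEq P] [DecidableEq Y] [DecidableEq g.Site] in
/-- the one-difference expansion of a symmetric word: `A·C·Aᵀ − A₁·C₁·A₁ᵀ = (A−A₁)·C·Aᵀ + A₁·(C−C₁)·Aᵀ + A₁·C₁·(A−A₁)ᵀ` (n15-c∕212 `mmul3_sub` with `B = Aᵀ`), for `mulVecLin`. [folklore] -/
theorem mulVecLin_mmul3_transpose_sub (A A₁ : Matrix P Y ℝ) (C C₁ : Matrix Y Y ℝ) :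
    Matrix.mulVecLin (A * C * Aᵀ) - Matrix.mulVecLin (A₁ * C₁ * A₁ᵀ) =
      Matrix.mulVecLin ((A - A₁) * C * Aᵀ) + Matrix.mulVecLin (A₁ * (C - C₁) * Aᵀ) + Matrix.mulVecLin (A₁ * C₁ * (A - A₁)ᵀ) := by
  have hm : A * C * Aᵀ - A₁ * C₁ * A₁ᵀ = (A - A₁) * C * Aᵀ + A₁ * (C - C₁) * Aᵀ + A₁ * C₁ * (A - A₁)ᵀ := by
    rw [Matrix.transpose_sub]
    simp only [Matrix.sub_mul, Matrix.mul_sub]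
    abel
  refine LinearMap.ext fun v => ?_
  simp only [LinearMap.sub_apply, LinearMap.add_apply, Matrix.mulVecLin_apply, ← Matrix.sub_mulVec, ← Matrix.add_mulVec, hm]

end Weighted

end Summit.QuantumFields.YangMills.BalabanUVNodes.N15.BlockRows

end
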